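import Mathlib.NumberTheory.LocalField.Basic
import Mathlib.NumberTheory.Padics.RingHoms
import Mathlib.RingTheory.AdicCompletion.RingHom
import Mathlib.GroupTheory.ArchimedeanDensely
import Literature.NumberTheory.Automorphic.AdicCompletionLocalField
import HarnessLib

/-!
# The canonical `ℚ_ℓ`-algebra structure of an `ℓ`-adic local field (and of `K_v`, `v ∣ ℓ`)

Topic `NumberTheory/GaloisRepresentations`. Let `K` be a non-archimedean local field (Mathlib's
`IsNonarchimedeanLocalField K`) of characteristic `0` whose residue characteristic is the prime
`ℓ`, i.e. `valuation K ℓ < 1`. Then `K` is canonically an extension of `ℚ_ℓ` (Serre, *Local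
Fields*, Ch. II §5; Neukirch, *Algebraic Number Theory*, Ch. II (5.2)): the closure of `ℚ` in `K`
is `ℚ_ℓ`. Neither Mathlib nor the accepted tree has this structure: every accepted consumer
carries it as a DATUM — `PstWeilDeligneData.algebra` (`PstWeilDeligne.lean`), the dependent pairs
`Σ' (_ : Algebra ℚ_[ℓ] (v.adicCompletion K)), …` of `GaloisRep.IsGeometric` (`PAdicHodge.lean`),
`LangHasseWeil`, `ReciprocityGLn`, `Taylor2006PotentialAutomorphy`, and the explicit argument
`alg : Algebra ℚ_[ℓ] (v.adicCompletion K)` of `LabelledHodgeTateWeights`. This file CONSTRUCTS it,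
purely algebraically, and proves that it is the unique such structure:

* `LocalField.toQuotPow K ℓ hℓ n : ℤ_[ℓ] →+* 𝒪[K] ⧸ 𝓂[K] ^ n` — the level-`n` map
  `ℤ_ℓ → ℤ/ℓⁿ → 𝒪_K/𝓂ⁿ` (well defined because `ℓⁿ ∈ 𝓂ⁿ`), a compatible family;
* `LocalField.padicIntRingHom K ℓ hℓ : ℤ_[ℓ] →+* 𝒪[K]` — its limit, by the universal property of
  the `𝓂`-adically complete ring `𝒪_K` (Mathlib `IsAdicComplete.liftRingHom`; `𝒪_K` is
  `𝓂`-adically complete for a local field, Mathlib `IsNonarchimedeanLocalField`); it is the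
  UNIQUE ring homomorphism `ℤ_ℓ → 𝒪_K` (`LocalField.eq_padicIntRingHom`: any such map kills `ℓⁿ`
  modulo `𝓂ⁿ`, hence factors through `ℤ/ℓⁿ`, whose ring maps are unique);
* `LocalField.padicRingHom K ℓ hℓ : ℚ_[ℓ] →+* K` (for `CharZero K`) — the extension to the
  fraction field `ℚ_ℓ = Frac ℤ_ℓ` (Mathlib `IsLocalization.lift`; a non-zero `ℓ`-adic integer
  `u ℓᵏ` goes to a unit times `ℓᵏ ≠ 0`), and `LocalField.padicAlgebra K ℓ hℓ : Algebra ℚ_[ℓ] K`;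
* API: `padicRingHom` maps `ℤ_ℓ` into `𝒪_K` (`valuation_padicRingHom_le_one`), is continuous
  (`continuous_padicRingHom`), and is the unique ring homomorphism `ℚ_ℓ → K` mapping `ℤ_ℓ` into
  `𝒪_K` (`eq_padicRingHom`), in particular the unique CONTINUOUS one
  (`eq_padicRingHom_of_continuous`);
* the case `K_v = v.adicCompletion K`, `K` a number field, `v ∣ ℓ` (i.e. `(ℓ : 𝓞 K) ∈ v.asIdeal`):
  `valuation_adicCompletion_natCast_lt_one` and
  `LocalField.adicCompletionPadicAlgebra v ℓ hv : Algebra ℚ_[ℓ] (v.adicCompletion K)` — the structure the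
  consumers above intend (the local-field structure of `K_v` is the accepted instance
  `instIsNonarchimedeanLocalFieldAdicCompletion`).

These are `def`s, not global instances: an instance keyed on the hypothesis `valuation K ℓ < 1`
cannot be found by class inference, and a global `Algebra ℚ_[ℓ] K` instance for all local fields
would collide with `Algebra.id` on `ℚ_[ℓ]` itself once Mathlib gives `ℚ_[ℓ]` a local-field
instance. Consumers write `letI := LocalField.padicAlgebra K ℓ hℓ`.

## Relation to the definition item `FontainePstWeilDeligneData`

The item asks for the GENUINE inhabitant of `PstWeilDeligneData (v.adicCompletion K) ℓ`
(`PstWeilDeligne.lean`): (i) the canonical `ℚ_ℓ`-algebra structure on `K_v` — THIS FILE;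
(ii) Fontaine's `B_dR(K_v)` as a `PeriodRingData` — NOT constructible at the pin: Mathlib's
`BDeRham` (`RingTheory/Perfectoid/BDeRham.lean`) is a bare ring (no `G_K`-action, no filtration,
not known to be a domain/DVR — listed as TODO there), and the datum's field `invariants_eq`
(`B_dR^{G_K} = K`) is the theorem of Tate–Sen–Fontaine (Fontaine 1994, Exp. II, Thm. 1.5.7 with
Exp. III §1.5), which needs `ℂ_ℓ^{G_K} = K` (Ax–Sen–Tate); (iii) `IsWeilDeligneOf ρ r :⇔ r ≅
WD(D_pst ρ)` needs `B_st`, `D_pst` and, for the axiom `exists_of_isDeRham`, Berger's theorem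
"de Rham ⇒ potentially semistable" (Berger 2002, Thm. 0.7) — none of which exists in Mathlib or
the tree. Components (ii)–(iii) are therefore left to their own items; nothing here pretends to
be them.

## References

* J.-P. Serre, *Local Fields* (GTM 67, 1979), Ch. II §4–§5 (structure of complete discretely
  valued fields of unequal characteristic: they contain `ℤ_p`, finitely generated over it in the
  local-field case).
* J. Neukirch, *Algebraic Number Theory* (1999), Ch. II, Prop. 5.2 (local fields of
  characteristic `0` are the finite extensions of `ℚ_p`).
-/

noncomputable section

open scoped ValuativeRel NumberField
open IsDedekindDomain ValuativeRel

namespace Literature.NumberTheory.GaloisRepresentations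

namespace LocalField

section General

variable (K : Type*) [Field K] [ValuativeRel K] [TopologicalSpace K] [IsNonarchimedeanLocalField K]
  (ℓ : ℕ) [Fact ℓ.Prime]

/-- The valuation ring `𝒪_K` of a non-archimedean local field is `𝓂_K`-adically complete
(Mathlib's instance, which is stated over a `UniformSpace`; here in the `TopologicalSpace`
spelling used by the tree, through the canonical uniformity of the additive group). [folklore] -/
theorem isAdicComplete_maximalIdeal : IsAdicComplete 𝓂[K] 𝒪[K] := by
  letI := IsTopologicalAddGroup.rightUniformSpace K
  haveI := isUniformAddGroup_of_addCommGroup (G := K)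
  infer_instance

variable {K ℓ} in
omit [Fact ℓ.Prime] in
/-- Residue characteristic `ℓ` (`|ℓ|_K < 1`) means `ℓ ∈ 𝓂_K`. [folklore] -/
theorem natCast_mem_maximalIdeal (hℓ : valuation K ℓ < 1) : ((ℓ : ℕ) : 𝒪[K]) ∈ 𝓂[K] := by
  rw [IsLocalRing.mem_maximalIdeal, mem_nonunits_iff,
    Valuation.Integer.not_isUnit_iff_valuation_lt_one]
  simpa using hℓ

variable {K ℓ} in
omit [Fact ℓ.Prime] in
/-- `ℓⁿ = 0` in `𝒪_K / 𝓂_Kⁿ` when `ℓ ∈ 𝓂_K`. [folklore] -/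
theorem natCast_pow_eq_zero (hℓ : valuation K ℓ < 1) (n : ℕ) :
    ((ℓ ^ n : ℕ) : 𝒪[K] ⧸ 𝓂[K] ^ n) = 0 := by
  rw [Nat.cast_pow, ← map_natCast (Ideal.Quotient.mk (𝓂[K] ^ n)), ← map_pow,
    Ideal.Quotient.eq_zero_iff_mem]
  exact Ideal.pow_mem_pow (natCast_mem_maximalIdeal hℓ) n

/-- The level-`n` map `ℤ_ℓ → ℤ/ℓⁿ → 𝒪_K/𝓂_Kⁿ`: Mathlib's `PadicInt.toZModPow n` followed by the
unique ring map out of `ℤ/ℓⁿ` (which exists because `ℓⁿ = 0` in `𝒪_K/𝓂_Kⁿ`,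
`natCast_pow_eq_zero`). [folklore] -/
def toQuotPow (hℓ : valuation K ℓ < 1) (n : ℕ) : ℤ_[ℓ] →+* 𝒪[K] ⧸ 𝓂[K] ^ n :=
  (ZMod.castHom (ringChar.dvd (natCast_pow_eq_zero hℓ n)) (𝒪[K] ⧸ 𝓂[K] ^ n)).comp
    (PadicInt.toZModPow n)

/-- The maps `toQuotPow n` form a compatible family along `𝒪_K/𝓂ⁿ → 𝒪_K/𝓂ᵐ`, `m ≤ n`
(from `PadicInt.zmod_cast_comp_toZModPow` and uniqueness of ring maps out of `ℤ/ℓⁿ`). [folklore] -/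
theorem factorPow_comp_toQuotPow (hℓ : valuation K ℓ < 1) {m n : ℕ} (h : m ≤ n) :
    (Ideal.Quotient.factorPow 𝓂[K] h).comp (toQuotPow K ℓ hℓ n) = toQuotPow K ℓ hℓ m := by
  rw [toQuotPow, toQuotPow, ← PadicInt.zmod_cast_comp_toZModPow m n h, ← RingHom.comp_assoc,
    ← RingHom.comp_assoc]
  congr 1
  exact Subsingleton.elim _ _

/-- **The canonical map `ℤ_ℓ → 𝒪_K`** for a local field `K` of residue characteristic `ℓ`: the
limit of the compatible family `toQuotPow` in the `𝓂_K`-adically complete ring `𝒪_K` (Mathlib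
`IsAdicComplete.liftRingHom`). Serre, *Local Fields*, Ch. II §5. [folklore] -/
def padicIntRingHom (hℓ : valuation K ℓ < 1) : ℤ_[ℓ] →+* 𝒪[K] :=
  haveI := isAdicComplete_maximalIdeal K
  IsAdicComplete.liftRingHom 𝓂[K] (toQuotPow K ℓ hℓ) fun h => factorPow_comp_toQuotPow K ℓ hℓ h

/-- `padicIntRingHom` reduces to `toQuotPow n` modulo `𝓂_Kⁿ`. [folklore] -/
@[simp] theorem mk_padicIntRingHom (hℓ : valuation K ℓ < 1) (n : ℕ) (x : ℤ_[ℓ]) :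
    Ideal.Quotient.mk (𝓂[K] ^ n) (padicIntRingHom K ℓ hℓ x) = toQuotPow K ℓ hℓ n x := by
  haveI := isAdicComplete_maximalIdeal K
  exact IsAdicComplete.mk_liftRingHom 𝓂[K] _ _ n x

variable {ℓ} in
/-- Two ring homomorphisms out of `ℤ_ℓ` which both kill `ℓⁿ` coincide: both factor through the
surjection `ℤ_ℓ → ℤ/ℓⁿ` (kernel `ℓⁿ ℤ_ℓ`, Mathlib `PadicInt.ker_toZModPow`), and ring maps out of
`ℤ/ℓⁿ` are unique. [folklore] -/
theorem padicInt_ringHom_ext {R : Type*} [Ring R] {n : ℕ} (φ ψ : ℤ_[ℓ] →+* R)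
    (hφ : φ ((ℓ : ℤ_[ℓ]) ^ n) = 0) (hψ : ψ ((ℓ : ℤ_[ℓ]) ^ n) = 0) : φ = ψ := by
  have hsurj : Function.Surjective (PadicInt.toZModPow (p := ℓ) n) := ZMod.ringHom_surjective _
  have hker : ∀ χ : ℤ_[ℓ] →+* R, χ ((ℓ : ℤ_[ℓ]) ^ n) = 0 →
      RingHom.ker (PadicInt.toZModPow (p := ℓ) n) ≤ RingHom.ker χ := by
    intro χ hχ x hx
    rw [PadicInt.ker_toZModPow, Ideal.mem_span_singleton] at hx
    obtain ⟨y, rfl⟩ := hx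
    rw [RingHom.mem_ker, map_mul, hχ, zero_mul]
  calc φ = ((RingHom.liftOfSurjective _ hsurj) ⟨φ, hker φ hφ⟩).comp (PadicInt.toZModPow n) :=
        (RingHom.liftOfSurjective_comp _ hsurj ⟨φ, hker φ hφ⟩).symm
    _ = ((RingHom.liftOfSurjective _ hsurj) ⟨ψ, hker ψ hψ⟩).comp (PadicInt.toZModPow n) := by
        rw [Subsingleton.elim ((RingHom.liftOfSurjective _ hsurj) ⟨φ, hker φ hφ⟩)
          ((RingHom.liftOfSurjective _ hsurj) ⟨ψ, hker ψ hψ⟩)]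
    _ = ψ := RingHom.liftOfSurjective_comp _ hsurj ⟨ψ, hker ψ hψ⟩

/-- **Uniqueness of `ℤ_ℓ → 𝒪_K`**: every ring homomorphism `ℤ_ℓ → 𝒪_K` is `padicIntRingHom`
(no continuity assumption: modulo `𝓂ⁿ` both kill `ℓⁿ`, `padicInt_ringHom_ext`, and `𝒪_K` is
`𝓂`-adically separated, Mathlib `IsAdicComplete.eq_liftRingHom`). [folklore] -/
theorem eq_padicIntRingHom (hℓ : valuation K ℓ < 1) (φ : ℤ_[ℓ] →+* 𝒪[K]) :
    φ = padicIntRingHom K ℓ hℓ := by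
  haveI := isAdicComplete_maximalIdeal K
  refine IsAdicComplete.eq_liftRingHom 𝓂[K] _ _ φ fun n => padicInt_ringHom_ext (n := n) _ _ ?_ ?_
  · rw [RingHom.comp_apply, map_pow, map_natCast, map_pow, map_natCast, ← Nat.cast_pow]
    exact natCast_pow_eq_zero hℓ n
  · rw [toQuotPow, RingHom.comp_apply, map_pow, map_natCast, ← Nat.cast_pow, ZMod.natCast_self,
      map_zero]

/-- Any two ring homomorphisms `ℤ_ℓ → 𝒪_K` agree. [folklore] -/
theorem padicInt_ringHom_integer_ext (hℓ : valuation K ℓ < 1) (φ ψ : ℤ_[ℓ] →+* 𝒪[K]) : φ = ψ :=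
  (eq_padicIntRingHom K ℓ hℓ φ).trans (eq_padicIntRingHom K ℓ hℓ ψ).symm

variable [CharZero K]

/-- A non-zero `ℓ`-adic integer `x = u ℓᵏ` (`u` a unit, Mathlib `PadicInt.unitCoeff_spec`) maps
to a unit of `K` under `ℤ_ℓ → 𝒪_K ⊆ K`, because `ℓ ≠ 0` in the characteristic-`0` field `K`.
[folklore] -/
theorem isUnit_padicIntRingHom (hℓ : valuation K ℓ < 1) (y : nonZeroDivisors ℤ_[ℓ]) :
    IsUnit ((𝒪[K].subtype.comp (padicIntRingHom K ℓ hℓ)) y) := by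
  have hy : (y : ℤ_[ℓ]) ≠ 0 := mem_nonZeroDivisors_iff_ne_zero.1 y.2
  rw [PadicInt.unitCoeff_spec hy, map_mul, map_pow, map_natCast]
  refine IsUnit.mul ((PadicInt.unitCoeff hy).isUnit.map _) (IsUnit.pow _ ?_)
  exact isUnit_iff_ne_zero.2 (Nat.cast_ne_zero.2 (Fact.out : ℓ.Prime).ne_zero)

/-- **The canonical embedding `ℚ_ℓ → K`** of a characteristic-`0` local field of residue
characteristic `ℓ`: the extension of `padicIntRingHom : ℤ_ℓ → 𝒪_K ⊆ K` to the fraction field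
`ℚ_ℓ` of `ℤ_ℓ` (Mathlib `IsLocalization.lift`, `PadicInt.isFractionRing`). Serre, *Local
Fields*, Ch. II §5; Neukirch, ANT Ch. II (5.2). [folklore] -/
def padicRingHom (hℓ : valuation K ℓ < 1) : ℚ_[ℓ] →+* K :=
  IsLocalization.lift (M := nonZeroDivisors ℤ_[ℓ]) (isUnit_padicIntRingHom K ℓ hℓ)

/-- On `ℤ_ℓ ⊆ ℚ_ℓ`, `padicRingHom` is `padicIntRingHom`. [folklore] -/
@[simp] theorem padicRingHom_coe (hℓ : valuation K ℓ < 1) (x : ℤ_[ℓ]) :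
    padicRingHom K ℓ hℓ x = padicIntRingHom K ℓ hℓ x :=
  IsLocalization.lift_eq (M := nonZeroDivisors ℤ_[ℓ]) (isUnit_padicIntRingHom K ℓ hℓ) x

/-- `padicRingHom` maps `ℤ_ℓ` into the valuation ring `𝒪_K`. [folklore] -/
theorem valuation_padicRingHom_le_one (hℓ : valuation K ℓ < 1) (x : ℤ_[ℓ]) :
    valuation K (padicRingHom K ℓ hℓ x) ≤ 1 := by
  rw [padicRingHom_coe]
  exact (padicIntRingHom K ℓ hℓ x).2

/-- **The canonical `ℚ_ℓ`-algebra structure** on a characteristic-`0` non-archimedean local field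
of residue characteristic `ℓ` (`algebraMap = padicRingHom`). A `def`, to be installed with
`letI` (see the module docstring). Serre, *Local Fields*, Ch. II §5. [folklore] -/
abbrev padicAlgebra (hℓ : valuation K ℓ < 1) : Algebra ℚ_[ℓ] K :=
  (padicRingHom K ℓ hℓ).toAlgebra

/-- Unfolding: the algebra map of `padicAlgebra` is `padicRingHom`. [folklore] -/
theorem algebraMap_padicAlgebra (hℓ : valuation K ℓ < 1) :
    (letI := padicAlgebra K ℓ hℓ; algebraMap ℚ_[ℓ] K) = padicRingHom K ℓ hℓ := rfl

/-- **Uniqueness of `ℚ_ℓ → K`**: a ring homomorphism `φ : ℚ_ℓ → K` mapping `ℤ_ℓ` into `𝒪_K` is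
`padicRingHom` (its restriction `ℤ_ℓ → 𝒪_K` is `padicIntRingHom` by `eq_padicIntRingHom`, and a
ring map out of the fraction field `ℚ_ℓ` is determined on `ℤ_ℓ`, Mathlib
`IsLocalization.ringHom_ext`). [folklore] -/
theorem eq_padicRingHom (hℓ : valuation K ℓ < 1) (φ : ℚ_[ℓ] →+* K)
    (hφ : ∀ x : ℤ_[ℓ], valuation K (φ x) ≤ 1) : φ = padicRingHom K ℓ hℓ := by
  set φ₀ : ℤ_[ℓ] →+* 𝒪[K] :=
    (φ.comp (algebraMap ℤ_[ℓ] ℚ_[ℓ])).codRestrict 𝒪[K] fun x => hφ x with hφ₀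
  have h₀ : φ₀ = padicIntRingHom K ℓ hℓ := eq_padicIntRingHom K ℓ hℓ φ₀
  refine IsLocalization.ringHom_ext (nonZeroDivisors ℤ_[ℓ]) (RingHom.ext fun x => ?_)
  have hx : (φ₀ x : K) = φ x := rfl
  rw [RingHom.comp_apply, RingHom.comp_apply, PadicInt.algebraMap_apply, padicRingHom_coe, ← h₀, hx]

/-- **The continuous embedding is unique**: a CONTINUOUS ring homomorphism `ℚ_ℓ → K` is
`padicRingHom` — it maps `ℤ_ℓ`, the closure of `ℤ` (Mathlib `PadicInt.denseRange_intCast`), into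
the closed subring `𝒪_K ⊇ ℤ` (Mathlib `Valuation.isClosed_integer`), so `eq_padicRingHom`
applies. [folklore] -/
theorem eq_padicRingHom_of_continuous (hℓ : valuation K ℓ < 1) (φ : ℚ_[ℓ] →+* K)
    (hφ : Continuous φ) : φ = padicRingHom K ℓ hℓ := by
  refine eq_padicRingHom K ℓ hℓ φ fun x => ?_
  have hcoe : Continuous ((↑) : ℤ_[ℓ] → ℚ_[ℓ]) := continuous_subtype_val
  have hc : IsClosed {x : ℤ_[ℓ] | valuation K (φ x) ≤ 1} :=
    (Valuation.isClosed_integer (v := valuation K)).preimage (hφ.comp hcoe)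
  refine PadicInt.denseRange_intCast.induction_on (p := fun x : ℤ_[ℓ] => valuation K (φ x) ≤ 1)
    x hc fun a => ?_
  have ha : (φ (a : ℤ_[ℓ]) : K) = ((a : 𝒪[K]) : K) := by simp
  rw [ha]
  exact (a : 𝒪[K]).2

omit [TopologicalSpace K] [IsNonarchimedeanLocalField K] in
/-- In characteristic `0`, `ℓ ≠ 0` in `K`, so `|ℓ|_K ≠ 0`. [folklore] -/
theorem valuation_natCast_ne_zero : valuation K ℓ ≠ 0 := by
  rw [ne_eq, map_eq_zero]
  exact Nat.cast_ne_zero.2 (Fact.out : ℓ.Prime).ne_zero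

/-- **`padicRingHom` is continuous**: on the ball `ℓⁿ ℤ_ℓ` its values have valuation
`≤ |ℓ|_Kⁿ`, and `|ℓ|_Kⁿ → 0` because `|ℓ|_K < 1` in the (multiplicatively archimedean, rank-one)
value group of the local field `K` (Mathlib `exists_pow_lt₀`). [folklore] -/
theorem continuous_padicRingHom (hℓ : valuation K ℓ < 1) : Continuous (padicRingHom K ℓ hℓ) := by
  apply continuous_of_continuousAt_zero (padicRingHom K ℓ hℓ)
  rw [ContinuousAt, map_zero,
    Metric.nhds_basis_ball.tendsto_iff (IsValuativeTopology.hasBasis_nhds_zero K)]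
  rintro γ -
  obtain ⟨n, hn⟩ := exists_pow_lt₀ hℓ γ
  have hℓ0 : (ℓ : ℚ_[ℓ]) ≠ 0 := Nat.cast_ne_zero.2 (Fact.out : ℓ.Prime).ne_zero
  have hℓpos : (0 : ℝ) < ℓ := Nat.cast_pos.2 (Fact.out : ℓ.Prime).pos
  refine ⟨(ℓ : ℝ) ^ (-(n : ℤ)), zpow_pos hℓpos _, fun x hx => ?_⟩
  rw [Metric.mem_ball, dist_zero_right] at hx
  -- `x = ℓⁿ y` with `y ∈ ℤ_ℓ`
  set y : ℚ_[ℓ] := x * ((ℓ : ℚ_[ℓ]) ^ n)⁻¹ with hy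
  have hy1 : ‖y‖ ≤ 1 := by
    rw [hy, norm_mul, norm_inv, Padic.norm_p_pow, ← zpow_neg, neg_neg, zpow_natCast]
    have h1 : ‖x‖ * (ℓ : ℝ) ^ n < (ℓ : ℝ) ^ (-(n : ℤ)) * (ℓ : ℝ) ^ n :=
      mul_lt_mul_of_pos_right hx (pow_pos hℓpos n)
    rw [zpow_neg, zpow_natCast, inv_mul_cancel₀ (pow_ne_zero n hℓpos.ne')] at h1
    exact h1.le
  have hx' : x = (ℓ : ℚ_[ℓ]) ^ n * y := by
    rw [hy, mul_left_comm, mul_inv_cancel₀ (pow_ne_zero n hℓ0), mul_one]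
  have hyv : valuation K (padicRingHom K ℓ hℓ y) ≤ 1 :=
    valuation_padicRingHom_le_one K ℓ hℓ ⟨y, hy1⟩
  rw [Set.mem_setOf_eq, hx', map_mul, map_pow, map_natCast, map_mul, map_pow]
  calc valuation K ℓ ^ n * valuation K (padicRingHom K ℓ hℓ y)
      ≤ valuation K ℓ ^ n * 1 := mul_le_mul_right hyv _
    _ < γ := by rw [mul_one]; exact hn

/-- With the canonical algebra structure, `algebraMap ℚ_ℓ K` is continuous. [folklore] -/
theorem continuous_algebraMap_padicAlgebra (hℓ : valuation K ℓ < 1) :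
    letI := padicAlgebra K ℓ hℓ; Continuous (algebraMap ℚ_[ℓ] K) :=
  continuous_padicRingHom K ℓ hℓ

end General

/-! ### The completion of a number field at a place above `ℓ` -/

section AdicCompletion

variable {K : Type*} [Field K] [NumberField K] (v : HeightOneSpectrum (𝓞 K)) (ℓ : ℕ)
  [Fact ℓ.Prime]

omit [Fact ℓ.Prime] in
/-- If `v ∣ ℓ`, i.e. `(ℓ : 𝓞 K) ∈ v`, then `|ℓ|_v < 1` in `K_v` (Mathlib
`valuedAdicCompletion_eq_valuation`, `valuation_lt_one_iff_mem`, transported to the valuation of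
the valuative relation of `K_v`, accepted `instValuativeRelAdicCompletion`). [folklore] -/
theorem valuation_adicCompletion_natCast_lt_one (hv : ((ℓ : ℕ) : 𝓞 K) ∈ v.asIdeal) :
    valuation (v.adicCompletion K) (ℓ : v.adicCompletion K) < 1 := by
  rw [← (valuation (v.adicCompletion K)).vlt_one_iff,
    (Valued.v (R := v.adicCompletion K)).vlt_one_iff]
  have h1 : (ℓ : v.adicCompletion K) = ((algebraMap (𝓞 K) K ℓ : K) : v.adicCompletion K) := by
    rw [← map_natCast (algebraMap (𝓞 K) (v.adicCompletion K)) ℓ]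
    rfl
  rw [h1, HeightOneSpectrum.adicCompletion.valued_coe]
  exact (v.valuation_lt_one_iff_mem (ℓ : 𝓞 K)).2 hv

/-- `K_v` has characteristic `0` (it contains the number field `K`). [folklore] -/
theorem charZero_adicCompletion : CharZero (v.adicCompletion K) :=
  charZero_of_injective_algebraMap (algebraMap K (v.adicCompletion K)).injective

/-- **The canonical `ℚ_ℓ`-algebra structure on `K_v` for `v ∣ ℓ`** — the structure INTENDED by
the datum fields `PstWeilDeligneData.algebra` and the dependent pairs
`Σ' (_ : Algebra ℚ_[ℓ] (v.adicCompletion K)), …` of the accepted tree: `LocalField.padicAlgebra`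
for the local field `K_v` (accepted instance `instIsNonarchimedeanLocalFieldAdicCompletion`).
Serre, *Local Fields*, Ch. II §5. [folklore] -/
abbrev adicCompletionPadicAlgebra
    (hv : ((ℓ : ℕ) : 𝓞 K) ∈ v.asIdeal) : Algebra ℚ_[ℓ] (v.adicCompletion K) :=
  haveI := charZero_adicCompletion v
  padicAlgebra (v.adicCompletion K) ℓ (valuation_adicCompletion_natCast_lt_one v ℓ hv)

/-- The algebra map of `adicCompletionPadicAlgebra` is continuous. [folklore] -/
theorem continuous_algebraMap_adicCompletionPadicAlgebra
    (hv : ((ℓ : ℕ) : 𝓞 K) ∈ v.asIdeal) :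
    letI := adicCompletionPadicAlgebra v ℓ hv; Continuous (algebraMap ℚ_[ℓ] (v.adicCompletion K)) :=
  haveI := charZero_adicCompletion v
  continuous_padicRingHom (v.adicCompletion K) ℓ (valuation_adicCompletion_natCast_lt_one v ℓ hv)

/-- The algebra map of `adicCompletionPadicAlgebra` is the unique continuous ring
homomorphism `ℚ_ℓ → K_v`. [folklore] -/
theorem eq_algebraMap_adicCompletionPadicAlgebra
    (hv : ((ℓ : ℕ) : 𝓞 K) ∈ v.asIdeal) (φ : ℚ_[ℓ] →+* v.adicCompletion K) (hφ : Continuous φ) :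
    φ = (letI := adicCompletionPadicAlgebra v ℓ hv; algebraMap ℚ_[ℓ] (v.adicCompletion K)) :=
  haveI := charZero_adicCompletion v
  eq_padicRingHom_of_continuous (v.adicCompletion K) ℓ
    (valuation_adicCompletion_natCast_lt_one v ℓ hv) φ hφ

end AdicCompletion

end LocalField

end Literature.NumberTheory.GaloisRepresentations
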